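import Summits.QuantumFields.YangMills.Theorems.UnitScaleTiltProp8HalvingA1Row165L5
import Summits.QuantumFields.YangMills.Theorems.UnitScaleTiltProp8HalvingELTracePairing
import HarnessLib

/-!
# Route `UnitScaleTilt`, crux K1 child «MinimiserStabilityRegPr» (stmt-QuantumFields-19200), registered stub V2′ `stub_halvingStep`
# (skeletons v8 5b4e846794b80374 / v10 `BirthV10`) — **THE (165)-A₁ ROW OF THE HALVING PACKAGE FROM THE TRACE PAIRING, ODD `L ≥ 5`** (owner socket (σ-3), file 9 — the
# end of this seat's chain): `HalvingA1Row165L5.row165_L5` (P2 side discharged) with its `hsol` DISCHARGED by `HalvingELTracePairing.sol158_of_tracePairing` (file 8 ∘ file 7),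
# the `ℂ`-linear kernel extension of P2's `G̃` built in the proof, and the current map `2•W₀` — so that the three (165)-A₁ letters of `HalvingAssembly(Interior).H_of_package(Int)`
# for `A₁ := A′ − H(QA′)` read, on every admissible cube sequence of every odd `L ≥ 5` (tori with `≥ 5L` big blocks), from EXACTLY:
# (i) ★w5's Euler–Lagrange trace pairing for the self-adjoint chart field `A′` and the self-adjoint current `W₀A′` at the directions `s•E` (`s ∈ ker Q` real, `E` self-adjoint),
# (ii) the residual-Landau slice (153) of `A′` per reading, (iii) Prop. 4's (98) for `W₀` (`C₄`, `a₃`), (iv) the (152) sizes `r < a₃` of `A′`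

Cell `ym3-torus` (HUMAN RULING D-0037, YM ladder rung R3 — continuum SU(2) YM₃ on the torus is a RUNG, not the Clay problem), width seat
`ym-ust-19200-w3` gen 3 (D-0149).  `--supports stmt-QuantumFields-19200 --as helper`; def-free, 0 sorry, standard axioms.

HONEST SCOPE.  A composition; (i)–(iv) are the pillars' (P5's criticality run through `FlatActionCritical.re_gradient_pairing_eq_zero_of_isMinOn_wilson` incl. print p. 297's
gauge-invariance extension to all of `ker Q`; P1's chart (152)–(153); P3b's (98) ✓ p600749 for the pure-action `W₀`, the dressing `C_E` = M2); `L = 3` and small tori NOT covered (P2).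
NOT a claim about the crux, the rung, or the mass gap.

References: T. Bałaban, CMP **102** (1985) 277–309 [Balaban1985Variational] (99)–(100) p.293, (127)–(133) pp.297–298, (152)–(153) p.301, (157)–(158) p.302, (165) p.304;
CMP **96** (1984) 223–250 [Balaban1984PropagatorsII] (2.1)–(2.2) p.224, (2.16) p.225, Prop. 2.6 (2.136) p.247, Cor. 2.8 (2.150)–(2.151) p.249.
-/

set_option autoImplicit false

noncomputable section

open scoped BigOperators InnerProductSpace Matrix Matrix.Norms.L2Operator

namespace Summit.QuantumFields.YangMills.Theorems.HalvingA1Row165TraceL5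

open Literature.MathematicalPhysics.QuantumFieldTheory.Balaban1983to89
open B6GlobalChartV1 (PV)
open B6SectADomainsV1 (Domains)
open B6SectAOperatorsV1 (BondIdx QE RE dsE)
open B8Ineq132 (BondTouches)
open B8Eq140Level (SideTouches)
open B8Eq143PlaqExpansion (pdiv)
open B8Eq146AExpansion (plaqCovDeriv)
open B8Thm2SetupTorus (pullDom)
open B10Eq27TorusAxialLog (pull transl)
open LatticeFieldCalculus (bondAvgIter)
open T3ContinuumYM3Torus (T3Family)
open FlatCubeOpsText (IsLevWeight)
open FlatOpsLettersAssembly (flatH)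
open FlatCubeSequenceAligned (cubeSeqMT3)
open HalvingA1Row165L5 (row165_L5)
open HalvingELTracePairing (sol158_of_tracePairing)

/-- `1 ≤ 3` (named once). [folklore] -/
private theorem hd3 : 1 ≤ 2 + 1 := by norm_num

/-- **THE (165)-A₁ ROW FROM THE TRACE PAIRING, EVERY ODD `L ≥ 5`** — see the module docstring; `A₁ := A′ − 𝔄`, `𝔄(b) = Σ_c (He_c)(b)·(QA′)(c)` with P2's `flatH`; the three conjuncts are
LITERALLY those of `HalvingA1Row165.row165_of_smallSolution_layer` for this `A₁` with bound `e ≥ max{B₀, 1 + B_M}·2C₄r²`.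
[cite: Balaban1985Variational, (127)-(133) pp.297-298, (152)-(153) p.301, (158) p.302, (165) p.304; Balaban1984PropagatorsII, (2.1)-(2.2) p.224, Prop. 2.6 (2.136) p.247] -/
theorem row165_of_tracePairing_L5 (ℓ : ℕ) (hL : Odd (ℓ + 1) ∧ 1 < ℓ + 1) (hℓ : 4 ≤ ℓ) :
    ∃ (Mh₀ R₀ : ℕ) (B₀ BM : ℝ), 0 ≤ B₀ ∧ 0 ≤ BM ∧
    ∀ (m : ℕ) (hm : 1 ≤ m) (n K : ℕ) (_ : 1 ≤ K - n) (_ : K - n + 1 ≤ m + K) {Mh R a' : ℕ} (_ : Mh = (ℓ + 1) ^ a') (_ : Mh₀ ≤ Mh) (_ : R₀ ≤ R)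
      (_ : a' + 3 ≤ m + n) (hM1 : 1 ≤ (ℓ + 1) * Mh) (x₀ : Site (PV 2 ℓ m K hd3 hL) 0) (ρ S : ℕ) (_ : R * ((ℓ + 1) * Mh) ≤ S) (_ : 1 ≤ ρ)
      (w : ℕ → PBond (PV 2 ℓ m K hd3 hL) 0 → ℝ)
      (_ : IsLevWeight (⟨ℓ + 1, hL, m, hm⟩ : T3Family) n K (cubeSeqMT3 (⟨ℓ + 1, hL, m, hm⟩ : T3Family) n K x₀ ρ S ((ℓ + 1) * Mh) hM1) w)
      (A' : PBond (PV 2 ℓ m K hd3 hL) 0 → Matrix (Fin 2) (Fin 2) ℂ) (_ : ∀ b, IsSelfAdjoint (A' b))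
      (W₀ : (PBond (PV 2 ℓ m K hd3 hL) 0 → Matrix (Fin 2) (Fin 2) ℂ) → (PBond (PV 2 ℓ m K hd3 hL) 0 → Matrix (Fin 2) (Fin 2) ℂ))
      (_ : ∀ b, IsSelfAdjoint (W₀ A' b)) {C₄ a₃ r e : ℝ}
      (_ : ∀ (Y : PBond (PV 2 ℓ m K hd3 hL) 0 → Matrix (Fin 2) (Fin 2) ℂ) (r' : ℝ), r' < a₃ → (∀ b, w 1 b * ‖Y b‖ ≤ r') →
        (∀ (b : PBond (PV 2 ℓ m K hd3 hL) 0) (ν : Fin 3), w 2 b * (((ℓ + 1 : ℕ) : ℝ)) ^ (K - n) * ‖Y ⟨b.src.shift ν, b.dir⟩ - Y b‖ ≤ r') →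
        ∀ b, w 3 b * ‖W₀ Y b‖ ≤ C₄ * r' ^ 2)
      -- (i) the trace pairing on `ker Q`, self-adjoint test matrices
      (_ : ∀ s : PBond (PV 2 ℓ m K hd3 hL) 0 → ℝ, QE (cubeSeqMT3 (⟨ℓ + 1, hL, m, hm⟩ : T3Family) n K x₀ ρ S ((ℓ + 1) * Mh) hM1) (WithLp.toLp 2 s) = 0 →
        ∀ E : Matrix (Fin 2) (Fin 2) ℂ, IsSelfAdjoint E →
        (((((((ℓ + 1 : ℕ) : ℝ)⁻¹) ^ (K - n) : ℝ) : ℂ) ^ 2 / 2) *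
            ∑ p : Plaq (PV 2 ℓ m K hd3 hL) 0, Matrix.trace ((A' ⟨p.src, p.μ⟩ + A' ⟨p.src.shift p.μ, p.ν⟩ - A' ⟨p.src.shift p.ν, p.μ⟩ - A' ⟨p.src, p.ν⟩) *
              (((s ⟨p.src, p.μ⟩ : ℝ) : ℂ) • E + ((s ⟨p.src.shift p.μ, p.ν⟩ : ℝ) : ℂ) • E - ((s ⟨p.src.shift p.ν, p.μ⟩ : ℝ) : ℂ) • E -
                ((s ⟨p.src, p.ν⟩ : ℝ) : ℂ) • E)) +
          (((((ℓ + 1 : ℕ) : ℝ)⁻¹) ^ (K - n) : ℝ) : ℂ) ^ 4 * ∑ b : PBond (PV 2 ℓ m K hd3 hL) 0, Matrix.trace (W₀ A' b * (((s b : ℝ) : ℂ) • E))).re = 0)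
      -- (ii) the slice, per reading
      (_ : ∀ φ : Matrix (Fin 2) (Fin 2) ℂ →ₗ[ℝ] ℝ,
        RE (cubeSeqMT3 (⟨ℓ + 1, hL, m, hm⟩ : T3Family) n K x₀ ρ S ((ℓ + 1) * Mh) hM1) ((((ℓ + 1 : ℕ) : ℝ)) ^ (K - n))
          (dsE ((((ℓ + 1 : ℕ) : ℝ)) ^ (K - n)) (WithLp.toLp 2 (fun b => φ (A' b)))) = 0)
      -- (iv) the (152) sizes of `A′`
      (_ : r < a₃) (_ : ∀ b, w 1 b * ‖A' b‖ ≤ r)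
      (_ : ∀ (b : PBond (PV 2 ℓ m K hd3 hL) 0) (ν : Fin 3), w 2 b * (((ℓ + 1 : ℕ) : ℝ)) ^ (K - n) * ‖A' ⟨b.src.shift ν, b.dir⟩ - A' b‖ ≤ r)
      (_ : B₀ * (2 * C₄ * r ^ 2) ≤ e) (_ : (1 + BM) * (2 * C₄ * r ^ 2) ≤ e),
      (∀ (z : B7Prop1Explicit.Site (PV 2 ℓ m K hd3 hL).d) (τ : Fin (PV 2 ℓ m K hd3 hL).d),
        SideTouches (pullDom (fun j => if K - n ≤ j then ({x₀} : Set (Site (PV 2 ℓ m K hd3 hL) 0)) else (∅ : Set (Site (PV 2 ℓ m K hd3 hL) 0))) (K - n)) z τ →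
        ‖(A' - fun b : PBond (PV 2 ℓ m K hd3 hL) 0 => ∑ c, flatH (⟨ℓ + 1, hL, m, hm⟩ : T3Family) n K (cubeSeqMT3 (⟨ℓ + 1, hL, m, hm⟩ : T3Family) n K x₀ ρ S ((ℓ + 1) * Mh) hM1) (Pi.single c 1) b •
            bondAvgIter (c.1.1 : ℕ) A' c.1.2) ⟨transl 0 z, τ⟩‖ ≤ e) ∧
      (∀ (z : B7Prop1Explicit.Site (PV 2 ℓ m K hd3 hL).d) (κ τ : Fin (PV 2 ℓ m K hd3 hL).d),
        SideTouches (pullDom (fun j => if K - n ≤ j then ({x₀} : Set (Site (PV 2 ℓ m K hd3 hL) 0)) else (∅ : Set (Site (PV 2 ℓ m K hd3 hL) 0))) (K - n)) z τ →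
        ‖(((((ℓ + 1 : ℕ) : ℝ))⁻¹) ^ (K - n))⁻¹ •
          ((A' - fun b : PBond (PV 2 ℓ m K hd3 hL) 0 => ∑ c, flatH (⟨ℓ + 1, hL, m, hm⟩ : T3Family) n K (cubeSeqMT3 (⟨ℓ + 1, hL, m, hm⟩ : T3Family) n K x₀ ρ S ((ℓ + 1) * Mh) hM1) (Pi.single c 1) b •
              bondAvgIter (c.1.1 : ℕ) A' c.1.2) ⟨(transl 0 z).shift κ, τ⟩ -
            (A' - fun b : PBond (PV 2 ℓ m K hd3 hL) 0 => ∑ c, flatH (⟨ℓ + 1, hL, m, hm⟩ : T3Family) n K (cubeSeqMT3 (⟨ℓ + 1, hL, m, hm⟩ : T3Family) n K x₀ ρ S ((ℓ + 1) * Mh) hM1) (Pi.single c 1) b •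
              bondAvgIter (c.1.1 : ℕ) A' c.1.2) ⟨transl 0 z, τ⟩)‖ ≤ e) ∧
      (∀ (z : B7Prop1Explicit.Site (PV 2 ℓ m K hd3 hL).d) (μ : Fin (PV 2 ℓ m K hd3 hL).d),
        BondTouches (pullDom (fun j => if K - n ≤ j then ({x₀} : Set (Site (PV 2 ℓ m K hd3 hL) 0)) else (∅ : Set (Site (PV 2 ℓ m K hd3 hL) 0))) (K - n)) z μ →
        ‖pdiv (((((ℓ + 1 : ℕ) : ℝ))⁻¹) ^ (K - n)) (1 : B7Prop1Explicit.Site (PV 2 ℓ m K hd3 hL).d → Fin (PV 2 ℓ m K hd3 hL).d → (Matrix (Fin 2) (Fin 2) ℂ)ˣ)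
            (plaqCovDeriv (((((ℓ + 1 : ℕ) : ℝ))⁻¹) ^ (K - n))
              (1 : B7Prop1Explicit.Site (PV 2 ℓ m K hd3 hL).d → Fin (PV 2 ℓ m K hd3 hL).d → (Matrix (Fin 2) (Fin 2) ℂ)ˣ)
              (pull (A' - fun b : PBond (PV 2 ℓ m K hd3 hL) 0 => ∑ c, flatH (⟨ℓ + 1, hL, m, hm⟩ : T3Family) n K (cubeSeqMT3 (⟨ℓ + 1, hL, m, hm⟩ : T3Family) n K x₀ ρ S ((ℓ + 1) * Mh) hM1)
                (Pi.single c 1) b • bondAvgIter (c.1.1 : ℕ) A' c.1.2) 0)) μ z‖ ≤ e) := by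
  obtain ⟨Mh₀, R₀, B₀, BM, hB₀, hBM, hmain⟩ := row165_L5 ℓ hL hℓ
  refine ⟨Mh₀, R₀, B₀, BM, hB₀, hBM, ?_⟩
  intro m hm n K hk1 hk' Mh R a' hMha hMh hR hsize hM1 x₀ ρ S hRS hρ1 w hw A' hA' W₀ hW₀ C₄ a₃ r e hWq hpair hslice hr h1 h2 he₁ he₂
  obtain ⟨Gt, hGt, -, hrow⟩ := hmain m hm n K hk1 hk' hMha hMh hR hsize hM1 x₀ ρ S hRS hρ1 w hw
  set F : T3Family := ⟨ℓ + 1, hL, m, hm⟩ with hF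
  set D := cubeSeqMT3 F n K x₀ ρ S ((ℓ + 1) * Mh) hM1 with hD
  -- the `ℂ`-linear kernel extension of `G̃`
  let G : (PBond (PV 2 ℓ m K hd3 hL) 0 → Matrix (Fin 2) (Fin 2) ℂ) →ₗ[ℂ] (PBond (PV 2 ℓ m K hd3 hL) 0 → Matrix (Fin 2) (Fin 2) ℂ) :=
    LinearMap.pi fun b => ∑ b', ((Gt (Pi.single b' 1) b : ℝ) : ℂ) • LinearMap.proj b'
  have hGker : ∀ (f : PBond (PV 2 ℓ m K hd3 hL) 0 → Matrix (Fin 2) (Fin 2) ℂ) (b : PBond (PV 2 ℓ m K hd3 hL) 0),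
      G f b = ∑ b', Gt (Pi.single b' 1) b • f b' := by
    intro f b
    simp only [G, LinearMap.pi_apply, LinearMap.coe_sum, Finset.sum_apply, LinearMap.smul_apply, LinearMap.coe_proj, Function.eval,
      Complex.coe_smul]
  -- the `HB` of (157) and the solution of (158) from the trace pairing
  set 𝔄 : PBond (PV 2 ℓ m K hd3 hL) 0 → Matrix (Fin 2) (Fin 2) ℂ := fun b => ∑ c, flatH F n K D (Pi.single c 1) b • bondAvgIter (c.1.1 : ℕ) A' c.1.2 with h𝔄
  have hsol158 := sol158_of_tracePairing (F := F) (n := n) (K := K) D hGt (𝔄 := 𝔄)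
    (𝒢 := fun b => ∑ b', Gt (Pi.single b' 1) b • ((2 : ℝ) • W₀ A' b')) hA' hW₀ hpair hslice (fun _ => rfl) (fun _ => rfl)
  -- the current map `2•W₀` and its (98)
  have hsol : (A' - 𝔄) + G ((fun Y b => (2 : ℝ) • W₀ Y b) ((A' - 𝔄) + 𝔄)) = 0 := by
    rw [sub_add_cancel]
    have hG𝒢 : G ((fun Y b => (2 : ℝ) • W₀ Y b) A') = fun b => ∑ b', Gt (Pi.single b' 1) b • ((2 : ℝ) • W₀ A' b') := by
      funext b
      exact hGker _ b
    rw [hG𝒢]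
    exact hsol158
  have hWq2 : ∀ (Y : PBond (PV 2 ℓ m K hd3 hL) 0 → Matrix (Fin 2) (Fin 2) ℂ) (r' : ℝ), r' < a₃ → (∀ b, w 1 b * ‖Y b‖ ≤ r') →
      (∀ (b : PBond (PV 2 ℓ m K hd3 hL) 0) (ν : Fin 3), w 2 b * (((ℓ + 1 : ℕ) : ℝ)) ^ (K - n) * ‖Y ⟨b.src.shift ν, b.dir⟩ - Y b‖ ≤ r') →
      ∀ b, w 3 b * ‖(fun Y b => (2 : ℝ) • W₀ Y b) Y b‖ ≤ (2 * C₄) * r' ^ 2 := by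
    intro Y r' hr' hY1 hY2 b
    have h := hWq Y r' hr' hY1 hY2 b
    have h2 : ‖(2 : ℝ) • W₀ Y b‖ = 2 * ‖W₀ Y b‖ := by rw [norm_smul, Real.norm_of_nonneg (by norm_num : (0 : ℝ) ≤ 2)]
    show w 3 b * ‖(2 : ℝ) • W₀ Y b‖ ≤ 2 * C₄ * r' ^ 2
    rw [h2]
    nlinarith [h]
  -- the (152) sizes of `A₁ + 𝔄 = A′`
  have h1' : ∀ b, w 1 b * ‖((A' - 𝔄) + 𝔄) b‖ ≤ r := fun b => by rw [sub_add_cancel]; exact h1 b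
  have h2' : ∀ (b : PBond (PV 2 ℓ m K hd3 hL) 0) (ν : Fin 3),
      w 2 b * (((ℓ + 1 : ℕ) : ℝ)) ^ (K - n) * ‖((A' - 𝔄) + 𝔄) ⟨b.src.shift ν, b.dir⟩ - ((A' - 𝔄) + 𝔄) b‖ ≤ r := fun b ν => by
    rw [sub_add_cancel]; exact h2 b ν
  -- the slice transported from `A′` to `A₁ = A′ − 𝔄` (`𝔄` a kernel image of `flatH`)
  have hslice' : ∀ φ : Matrix (Fin 2) (Fin 2) ℂ →ₗ[ℝ] ℝ,
      RE D ((((ℓ + 1 : ℕ) : ℝ)) ^ (K - n)) (dsE ((((ℓ + 1 : ℕ) : ℝ)) ^ (K - n)) (WithLp.toLp 2 (fun b => φ ((A' - 𝔄) b)))) = 0 :=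
    HalvingELJunction.slice_of_decomp (F := F) (n := n) (K := K) D (A := A') (A₁ := A' - 𝔄) (𝔄 := 𝔄) (R := 0)
      (B := fun c => bondAvgIter (c.1.1 : ℕ) A' c.1.2) (B' := fun _ => 0) (by rw [sub_zero]; exact (sub_add_cancel A' 𝔄).symm) (fun _ => rfl)
      (fun b => by simp) hslice
  exact hrow G hGker (fun Y b => (2 : ℝ) • W₀ Y b) hWq2 hsol hr h1' h2' hslice' he₁ he₂

end Summit.QuantumFields.YangMills.Theorems.HalvingA1Row165TraceL5

end
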